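import Literature.Computation.Certificates.Blocks
import Summits.Ventures.GridStability.Lyapunov.NE39SPSlabCId1
import Summits.Ventures.GridStability.Lyapunov.NE39SPSlabCId2
import Summits.Ventures.GridStability.Lyapunov.NE39SPSlabCId3
import Summits.Ventures.GridStability.Lyapunov.NE39SPSlabCId4
import Summits.Ventures.GridStability.Lyapunov.NE39SPSlabCId5
import Summits.Ventures.GridStability.Lyapunov.NE39SPSlabCId6

/-!
# GridStability/Lyapunov/NE39SPSlabCPsd — «G2.b-NE39SP-SLAB-CLQ» (#53): the assembled clique-sum identities and the two PSD facts over `ℝ`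

Cell `gridfusion` (LADDER-GRIDFUSION G2, SP–Lur'e lane), row candidate «G2.b-NE39SP-SLAB-CLQ» (#53; lead RULING (R-a) AMENDED
2026-08-27T08:21:56Z «sos-4: FILE PSD»): the n = 58 structure-preserving NE39 slab row by the CLIQUE route. OBJECT `NE39SP.relLurie D`
(Models/NE39SPLurie.lean: 58 states `Fin 48 ⊕ Fin 10`, 56 lines, reference bus 39) with D = `1/10` at all 49 nodes — SYNTHETIC
uniform damping (declared; MODEL-VALIDITY SP–Lur'e block). CERTIFICATE (seat gridfusion-sos-4 g4, kit j272825, file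
`cert/sos-4/j272825/lchord-R5-NE39SP-D1o10-nbr-csJ.json` sha16 3f9f274c5104abf6): a Lur'e–Postnikov slab certificate (slab `u = 1/4`, sectors `a = 5/8`,
`b = 1`, `η = 1/1000`, Popov on all 56 lines) whose Lyapunov matrix `P` is STRUCTURED (nonzero 2-node blocks only on network
lines, pattern «nbr») so that `−𝓛` (114 × 114) is the SUM of 64 clique-embedded blocks ≤ 19 × 19 and `P − ε·1` (58 × 58) the sum
of 41 blocks ≤ 4 × 4 [cite: ZhengFantuzziPapachristodoulou2018, §3.2 Theorem 2 (Agler)], every block carrying an integer Gram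
certificate of ≤ 35 digits (solver: Clarabel on a per-index Jacobi-scaled LMI, objective = maximise the common block margin δ (ε_P = κδ, κ = 1); dyadic rounding,
Peyrl–Parrilo projection onto the clique identities, exact re-verification — all VALIDATED-column provenance). DATA module:
`Summits.Ventures.GridStability.Lyapunov.NE39SPSlabCData` (`AqS`, `PSq`, `epsSQ`, `tauSQ`, `lamSQ`; typed by gridfusion-model-2 (p514683) from sos-4's hand-over 5a053876f8a67723 — literals re-matched exactly against this certificate by the generator's companion check). Index convention
(global LMI index `Fin 114`): `i < 48` ↦ state `inl i` (relative angle), `48 + j` ↦ state `inr j` (machine speed), `58 + e` ↦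
line/channel `e` — i.e. model-2's `e2 : (Fin 48 ⊕ Fin 10) ⊕ Fin 56 ≃ Fin 114`. THREE COLUMNS: these files are exact DATA +
kernel-decided PSD facts about the literal matrices `AqS` / `PSq − ε·1`; that `AqS` IS `−slabMatrix (relLurie D) P η λ τ a b` is the
Bench/Id step (model-2); nothing here says the New England system is stable; the region these data will certify is an inner
estimate for a structure-preserving NE39 VARIANT with DECLARED SYNTHETIC damping. Generator `sos4/gen_slabS_lean.py` (HOME/cert/sos-4/).

This file: `aqS_eq_sum : AqS = sumL` (from the row shards), `peS_eq_sum : P − ε·1 = sumP` (one cheap decide, 58 × 58, 41 blocks ≤ 4), and the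
conclusions `aqS_posSemidef : (AqS.map Rat.cast).PosSemidef`, `peS_posSemidef : ((PSq − ε·1).map Rat.cast).PosSemidef` over `ℝ` as chains of
`PSD.PosSemidef.add_embedAt` over the blocks' Gram-certified positivity [cite: ZhengFantuzziPapachristodoulou2018, §3.2 Theorem 2 («if» direction)] —
the two matrix facts a `SlabCertificate (NE39SP.relLurie D)` needs, up to the Bench/Id step (model-2: `−slabMatrix … = AqS.submatrix e2 e2`).
-/

set_option linter.style.longLine false
set_option maxRecDepth 100000

open Matrix Literature.Computation.Certificates

namespace Summit.Ventures.GridStability.Lyapunov.NE39SPSlabC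

/-- **`AqS` is the sum of the 64 clique-embedded blocks** (assembled from the row shards). -/
theorem aqS_eq_sum : AqS = sumL :=
  Matrix.ext fun i j => (forall_fin_of_blocks 19 (by norm_num) (fun c => by
    fin_cases c
    exacts [aq_rows_0, aq_rows_1, aq_rows_2, aq_rows_3, aq_rows_4, aq_rows_5]) : ∀ i : Fin 114, ∀ j, AqS i j = sumL i j) i j

set_option maxHeartbeats 1600000 in
/-- identity `P − ε·1 = sumP` (kernel; 58 × 58, 41 blocks ≤ 4). -/
theorem pe_rows : ∀ i j, PeS i j = sumP i j := by
  decide +kernel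
/-- **`P − ε·1` is the sum of the 41 clique-embedded blocks.** -/
theorem peS_eq_sum : PeS = sumP := Matrix.ext fun i j => pe_rows i j

/-- **`AqS ↦ ℝ ⪰ 0`**: the exact 114 × 114 matrix (claimed `−𝓛` of the structured slab certificate) is positive semidefinite over `ℝ` — a sum of 64
clique-embedded Gram-certified blocks. [cite: ZhengFantuzziPapachristodoulou2018, §3.2 Theorem 2 («if» direction)] -/
theorem aqS_posSemidef : (AqS.map (Rat.cast : ℚ → ℝ)).PosSemidef := by
  rw [aqS_eq_sum, sumL]
  simp only [Matrix.map_add (Rat.cast : ℚ → ℝ) Rat.cast_add, PSD.embedAt_map _ _ (Rat.cast : ℚ → ℝ) Rat.cast_zero]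
  exact (PSD.PosSemidef.add_embedAt (PSD.PosSemidef.add_embedAt (PSD.PosSemidef.add_embedAt (PSD.PosSemidef.add_embedAt (PSD.PosSemidef.add_embedAt (PSD.PosSemidef.add_embedAt (PSD.PosSemidef.add_embedAt (PSD.PosSemidef.add_embedAt (PSD.PosSemidef.add_embedAt (PSD.PosSemidef.add_embedAt (PSD.PosSemidef.add_embedAt (PSD.PosSemidef.add_embedAt (PSD.PosSemidef.add_embedAt (PSD.PosSemidef.add_embedAt (PSD.PosSemidef.add_embedAt (PSD.PosSemidef.add_embedAt (PSD.PosSemidef.add_embedAt (PSD.PosSemidef.add_embedAt (PSD.PosSemidef.add_embedAt (PSD.PosSemidef.add_embedAt (PSD.PosSemidef.add_embedAt (PSD.PosSemidef.add_embedAt (PSD.PosSemidef.add_embedAt (PSD.PosSemidef.add_embedAt (PSD.PosSemidef.add_embedAt (PSD.PosSemidef.add_embedAt (PSD.PosSemidef.add_embedAt (PSD.PosSemidef.add_embedAt (PSD.PosSemidef.add_embedAt (PSD.PosSemidef.add_embedAt (PSD.PosSemidef.add_embedAt (PSD.PosSemidef.add_embedAt (PSD.PosSemidef.add_embedAt (PSD.PosSemidef.add_embedAt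 (PSD.PosSemidef.add_embedAt (PSD.PosSemidef.add_embedAt (PSD.PosSemidef.add_embedAt (PSD.PosSemidef.add_embedAt (PSD.PosSemidef.add_embedAt (PSD.PosSemidef.add_embedAt (PSD.PosSemidef.add_embedAt (PSD.PosSemidef.add_embedAt (PSD.PosSemidef.add_embedAt (PSD.PosSemidef.add_embedAt (PSD.PosSemidef.add_embedAt (PSD.PosSemidef.add_embedAt (PSD.PosSemidef.add_embedAt (PSD.PosSemidef.add_embedAt (PSD.PosSemidef.add_embedAt (PSD.PosSemidef.add_embedAt (PSD.PosSemidef.add_embedAt (PSD.PosSemidef.add_embedAt (PSD.PosSemidef.add_embedAt (PSD.PosSemidef.add_embedAt (PSD.PosSemidef.add_embedAt (PSD.PosSemidef.add_embedAt (PSD.PosSemidef.add_embedAt (PSD.PosSemidef.add_embedAt (PSD.PosSemidef.add_embedAt (PSD.PosSemidef.add_embedAt (PSD.PosSemidef.add_embedAt (PSD.PosSemidef.add_embedAt (PSD.PosSemidef.add_embedAt (PSD.posSemidef_embedAt _ psdL_0) _ psdL_1) _ psdL_2) _ psdL_3) _ psdL_4) _ psdL_5) _ psdL_6) _ psdL_7)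 _ psdL_8) _ psdL_9) _ psdL_10) _ psdL_11) _ psdL_12) _ psdL_13) _ psdL_14) _ psdL_15) _ psdL_16) _ psdL_17) _ psdL_18) _ psdL_19) _ psdL_20) _ psdL_21) _ psdL_22) _ psdL_23) _ psdL_24) _ psdL_25) _ psdL_26) _ psdL_27) _ psdL_28) _ psdL_29) _ psdL_30) _ psdL_31) _ psdL_32) _ psdL_33) _ psdL_34) _ psdL_35) _ psdL_36) _ psdL_37) _ psdL_38) _ psdL_39) _ psdL_40) _ psdL_41) _ psdL_42) _ psdL_43) _ psdL_44) _ psdL_45) _ psdL_46) _ psdL_47) _ psdL_48) _ psdL_49) _ psdL_50) _ psdL_51) _ psdL_52) _ psdL_53) _ psdL_54) _ psdL_55) _ psdL_56) _ psdL_57) _ psdL_58) _ psdL_59) _ psdL_60) _ psdL_61) _ psdL_62) _ psdL_63)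

/-- **`(P − ε·1) ↦ ℝ ⪰ 0`** — a sum of 41 clique-embedded Gram-certified blocks. [cite: ZhengFantuzziPapachristodoulou2018, §3.2 Theorem 2 («if» direction)] -/
theorem peS_posSemidef : ((PSq - epsSQ • (1 : Matrix (Fin 58) (Fin 58) ℚ)).map (Rat.cast : ℚ → ℝ)).PosSemidef := by
  rw [show PSq - epsSQ • (1 : Matrix (Fin 58) (Fin 58) ℚ) = sumP from peS_eq_sum, sumP]
  simp only [Matrix.map_add (Rat.cast : ℚ → ℝ) Rat.cast_add, PSD.embedAt_map _ _ (Rat.cast : ℚ → ℝ) Rat.cast_zero]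
  exact (PSD.PosSemidef.add_embedAt (PSD.PosSemidef.add_embedAt (PSD.PosSemidef.add_embedAt (PSD.PosSemidef.add_embedAt (PSD.PosSemidef.add_embedAt (PSD.PosSemidef.add_embedAt (PSD.PosSemidef.add_embedAt (PSD.PosSemidef.add_embedAt (PSD.PosSemidef.add_embedAt (PSD.PosSemidef.add_embedAt (PSD.PosSemidef.add_embedAt (PSD.PosSemidef.add_embedAt (PSD.PosSemidef.add_embedAt (PSD.PosSemidef.add_embedAt (PSD.PosSemidef.add_embedAt (PSD.PosSemidef.add_embedAt (PSD.PosSemidef.add_embedAt (PSD.PosSemidef.add_embedAt (PSD.PosSemidef.add_embedAt (PSD.PosSemidef.add_embedAt (PSD.PosSemidef.add_embedAt (PSD.PosSemidef.add_embedAt (PSD.PosSemidef.add_embedAt (PSD.PosSemidef.add_embedAt (PSD.PosSemidef.add_embedAt (PSD.PosSemidef.add_embedAt (PSD.PosSemidef.add_embedAt (PSD.PosSemidef.add_embedAt (PSD.PosSemidef.add_embedAt (PSD.PosSemidef.add_embedAt (PSD.PosSemidef.add_embedAt (PSD.PosSemidef.add_embedAt (PSD.PosSemidef.add_embedAt (PSD.PosSemidef.add_embedAt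 (PSD.PosSemidef.add_embedAt (PSD.PosSemidef.add_embedAt (PSD.PosSemidef.add_embedAt (PSD.PosSemidef.add_embedAt (PSD.PosSemidef.add_embedAt (PSD.PosSemidef.add_embedAt (PSD.posSemidef_embedAt _ psdP_0) _ psdP_1) _ psdP_2) _ psdP_3) _ psdP_4) _ psdP_5) _ psdP_6) _ psdP_7) _ psdP_8) _ psdP_9) _ psdP_10) _ psdP_11) _ psdP_12) _ psdP_13) _ psdP_14) _ psdP_15) _ psdP_16) _ psdP_17) _ psdP_18) _ psdP_19) _ psdP_20) _ psdP_21) _ psdP_22) _ psdP_23) _ psdP_24) _ psdP_25) _ psdP_26) _ psdP_27) _ psdP_28) _ psdP_29) _ psdP_30) _ psdP_31) _ psdP_32) _ psdP_33) _ psdP_34) _ psdP_35) _ psdP_36) _ psdP_37) _ psdP_38) _ psdP_39) _ psdP_40)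

end Summit.Ventures.GridStability.Lyapunov.NE39SPSlabC
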